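import Literature.AlgebraicGeometry.Motives.JacobianGaloisDescent
import Literature.AlgebraicGeometry.Resolution.FiniteSubextensionDescent
import Mathlib.FieldTheory.Normal.Closure
import HarnessLib

/-!
# Invariant ideal sheaves on `X_K` come from a finite normal stage, equivariantly
# (`K/k` normal algebraic, `X` of finite type; Görtz–Wedhorn I, Thm. 10.66 and §(14.20))

Preparation for Galois descent of ideal sheaves along an INFINITE Galois extension (companion of
`GaloisDescentIdealSheaf.lean`, which treats finite Galois extensions). For an algebraic normal
extension `K/k`, a `k`-scheme `X` OF FINITE TYPE, the base changes `X_K = X ×_k Spec K`,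
`X_E = X ×_k Spec E` (`E` a subextension) with their Galois automorphisms `gal`
(`Motives/JacobianGaloisDescent`), and ANY transition map `r : X_K → X_E` over `X` compatible with
`Spec K → Spec E` (no definition is introduced; cf. the presentation-free interface of
`Resolution/FiniteSubextensionDescent.lean`):

* `gal_comp_eq_comp_gal` — if `σ ∈ Aut(K/k)` restricts to `τ ∈ Aut(E/k)` then
  `gal σ ≫ r = r ≫ gal τ`;
* `comap_gal_map_eq_map` — if an ideal sheaf `I` on `X_K` is invariant under all `gal σ`,
  `σ ∈ Aut(K/k)`, then its push-forward `I.map r` is invariant under all `gal τ`, `τ ∈ Aut(E/k)`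
  (lift `τ` to `K`, Mathlib `AlgEquiv.liftNormal`);
* `exists_normal_stage` — every ideal sheaf `I` on `X_K` satisfies `(I.map r)·𝒪_{X_K} = I` for
  every such `r` into a suitable subextension `E` FINITE AND NORMAL over `k` (the tree's
  `Resolution.closedSubscheme_descent_eventually` = Görtz–Wedhorn I, Thm. 10.66 / EGA IV₃ 8.8.2,
  applied over the bottom stage `⊥ ≅ k`, then a normal closure);
* the cartesian presentations of `X_E`, `X_K` over the bottom stage `⊥` of the tower
  (`isPullback_bot_stage`, `isPullback_bot_top`).

Requested by the lead of crux `DescentAlgclosedToPerfect` (stmt-ResolutionOfSingularities-0550):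
with finite Galois descent of ideal sheaves this descends an `Aut(k̄/k)`-invariant resolving ideal
of `X_{k̄}` to `X`. Everything is proved; no definitions, no named facts.

## References

* U. Görtz, T. Wedhorn, *Algebraic Geometry I: Schemes*, 2nd ed. (2020), Thm. 10.66, Prop. 10.75,
  §(14.20). [GortzWedhorn2020]
* A. Grothendieck, J. Dieudonné, EGA IV₃ (1966), 8.8.2.
-/

noncomputable section

open CategoryTheory CategoryTheory.Limits AlgebraicGeometry TopologicalSpace

universe u

namespace Literature.AlgebraicGeometry.Motives

namespace GaloisDescent

open AbelianVariety (bcSpec specAut specAut_mul specAut_one)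
open Literature.AlgebraicGeometry.Resolution (specTo_comp_specOf closedSubscheme_descent_eventually)

set_option backward.isDefEq.respectTransparency false

variable {k : Type u} [Field k] (K : Type u) [Field K] [Algebra k K] (X : SchemeOver k)

/-! ## Galois automorphisms and transition maps -/

/-- **The Galois actions are compatible with restriction**: for a transition map `r : X_K → X_E`
over `X` covering `Spec K → Spec E`, if `σ ∈ Aut(K/k)` restricts to `τ ∈ Aut(E/k)` on `E` then
`gal σ ≫ r = r ≫ gal τ`. [cite: GortzWedhorn2020, §(14.20)] -/
@[reassoc]
theorem gal_comp_eq_comp_gal (E : IntermediateField k K) (r : bc K X ⟶ bc (↥E) X)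
    (hr₁ : r ≫ pullback.fst X.hom (bcSpec k ↥E) = pullback.fst X.hom (bcSpec k K))
    (hr₂ : r ≫ pullback.snd X.hom (bcSpec k ↥E) =
      pullback.snd X.hom (bcSpec k K) ≫ Spec.map (CommRingCat.ofHom (algebraMap (↥E) K)))
    (σ : K ≃ₐ[k] K) (τ : (↥E) ≃ₐ[k] ↥E)
    (h : ∀ x : ↥E, σ (algebraMap (↥E) K x) = algebraMap (↥E) K (τ x)) :
    gal K X σ ≫ r = r ≫ gal (↥E) X τ := by
  have hring : (CommRingCat.ofHom (algebraMap (↥E) K)) ≫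
      CommRingCat.ofHom ((σ⁻¹ : K ≃ₐ[k] K) : K →+* K) =
      CommRingCat.ofHom ((τ⁻¹ : (↥E) ≃ₐ[k] ↥E) : (↥E) →+* ↥E) ≫
        CommRingCat.ofHom (algebraMap (↥E) K) := by
    ext x
    change σ⁻¹ (algebraMap (↥E) K x) = algebraMap (↥E) K (τ⁻¹ x)
    apply σ.injective
    rw [AlgEquiv.aut_inv, AlgEquiv.aut_inv, AlgEquiv.apply_symm_apply, h, AlgEquiv.apply_symm_apply]
  apply pullback.hom_ext
  · simp only [Category.assoc, hr₁, gal_fst]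
  · simp only [Category.assoc, hr₂, gal_snd, gal_snd_assoc]
    rw [reassoc_of% hr₂, ← Spec.map_comp, ← Spec.map_comp, hring]

/-- **Invariance passes to the finite stage**: if `I` is invariant under `Aut(K/k)` (`K/k` normal),
its push-forward `I.map r` along a transition map `r : X_K → X_E` is invariant under `Aut(E/k)`
(lift `τ` to `K` by Mathlib's `AlgEquiv.liftNormal`). [cite: GortzWedhorn2020, Thm. 14.83] -/
theorem comap_gal_map_eq_map [Normal k K] (E : IntermediateField k K) (r : bc K X ⟶ bc (↥E) X)
    (hr₁ : r ≫ pullback.fst X.hom (bcSpec k ↥E) = pullback.fst X.hom (bcSpec k K))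
    (hr₂ : r ≫ pullback.snd X.hom (bcSpec k ↥E) =
      pullback.snd X.hom (bcSpec k K) ≫ Spec.map (CommRingCat.ofHom (algebraMap (↥E) K)))
    (I : (bc K X).IdealSheafData) (hI : ∀ σ : K ≃ₐ[k] K, I.comap (gal K X σ) = I)
    (τ : (↥E) ≃ₐ[k] ↥E) : (I.map r).comap (gal (↥E) X τ) = I.map r := by
  -- one inclusion for every `τ`, from the lift of `τ` to `K`
  have hle : ∀ τ : (↥E) ≃ₐ[k] ↥E, (I.map r).comap (gal (↥E) X τ) ≤ I.map r := by
    intro τ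
    have hc := gal_comp_eq_comp_gal K X E r hr₁ hr₂ (τ.liftNormal K) τ
      fun x => τ.liftNormal_commutes K x
    rw [Scheme.IdealSheafData.le_map_iff_comap_le, ← Scheme.IdealSheafData.comap_comp, ← hc,
      Scheme.IdealSheafData.comap_comp]
    calc ((I.map r).comap r).comap (gal K X (τ.liftNormal K))
        ≤ I.comap (gal K X (τ.liftNormal K)) :=
          Scheme.IdealSheafData.comap_mono _ (Scheme.IdealSheafData.comap_map_le _ _)
      _ = I := hI _
  refine le_antisymm (hle τ) ?_
  calc I.map r = ((I.map r).comap (gal (↥E) X τ⁻¹)).comap (gal (↥E) X τ) := by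
        rw [← Scheme.IdealSheafData.comap_comp, gal_comp_gal_symm, Scheme.IdealSheafData.comap_id]
    _ ≤ (I.map r).comap (gal (↥E) X τ) := Scheme.IdealSheafData.comap_mono _ (hle τ⁻¹)

/-! ## The bottom stage `⊥ ≅ k` of the tower and the finite normal stage -/

variable (k) in
/-- `⊥ ≅ k` (Mathlib `botEquiv`) gives an isomorphism of rings in `CommRingCat`. [folklore] -/
theorem isIso_ofHom_botEquiv : IsIso (CommRingCat.ofHom ((IntermediateField.botEquiv k K :
    (⊥ : IntermediateField k K) ≃ₐ[k] k) : (⊥ : IntermediateField k K) →+* k)) :=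
  ⟨CommRingCat.ofHom
      (((IntermediateField.botEquiv k K).symm : k ≃ₐ[k] (⊥ : IntermediateField k K)) :
        k →+* (⊥ : IntermediateField k K)),
    by ext x; simp, by ext x; simp⟩

variable (k) in
/-- `algebraMap k K ∘ botEquiv = (⊥ : IntermediateField k K) ↪ K`. [folklore] -/
theorem algebraMap_comp_botEquiv :
    (algebraMap k K).comp ((IntermediateField.botEquiv k K :
      (⊥ : IntermediateField k K) ≃ₐ[k] k) : (⊥ : IntermediateField k K) →+* k) =
      algebraMap (↥(⊥ : IntermediateField k K)) K := by
  ext y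
  obtain ⟨x, rfl⟩ : ∃ x : k, algebraMap k (⊥ : IntermediateField k K) x = y :=
    ⟨IntermediateField.botEquiv k K y, by
      rw [← IntermediateField.botEquiv_symm, AlgEquiv.symm_apply_apply]⟩
  rw [RingHom.comp_apply, ← IsScalarTower.algebraMap_apply]
  change algebraMap k K (IntermediateField.botEquiv k K (algebraMap k _ x)) = _
  rw [IntermediateField.botEquiv_def]

/-- `X_E → X`, `X_E → Spec E` present `X ×_⊥ Spec E` over the bottom stage `X → Spec k ≅ Spec ⊥`.
[folklore] -/
theorem isPullback_bot_stage (E : IntermediateField k K) :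
    IsPullback (pullback.fst X.hom (bcSpec k ↥E)) (pullback.snd X.hom (bcSpec k ↥E))
      (X.hom ≫ Spec.map (CommRingCat.ofHom ((IntermediateField.botEquiv k K :
        (⊥ : IntermediateField k K) ≃ₐ[k] k) : (⊥ : IntermediateField k K) →+* k)))
      (Spec.map (CommRingCat.ofHom (AlgHom.toRingHom
        (IntermediateField.inclusion (bot_le : (⊥ : IntermediateField k K) ≤ E))))) := by
  haveI := isIso_ofHom_botEquiv k K
  refine (IsPullback.of_hasPullback X.hom (bcSpec k ↥E)).of_iso (Iso.refl _) (Iso.refl _)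
    (Iso.refl _) (asIso (Spec.map (CommRingCat.ofHom ((IntermediateField.botEquiv k K :
        (⊥ : IntermediateField k K) ≃ₐ[k] k) : (⊥ : IntermediateField k K) →+* k))))
    (by simp) (by simp) (by rw [Iso.refl_hom, Category.id_comp]; rfl) ?_
  rw [Iso.refl_hom, Category.id_comp, asIso_hom, ← Spec.map_comp]
  congr 1
  ext y
  change ((algebraMap k (↥E) (IntermediateField.botEquiv k K y) : ↥E) : K) =
    ((IntermediateField.inclusion bot_le y : ↥E) : K)
  rw [IntermediateField.coe_inclusion, IntermediateField.coe_algebraMap_apply,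
    ← IntermediateField.algebraMap_apply (⊥ : IntermediateField k K) y]
  exact congrFun (congrArg DFunLike.coe (algebraMap_comp_botEquiv k K)) y

/-- `X_K → X`, `X_K → Spec K` present `X ×_⊥ Spec K` over the bottom stage. [folklore] -/
theorem isPullback_bot_top :
    IsPullback (pullback.fst X.hom (bcSpec k K)) (pullback.snd X.hom (bcSpec k K))
      (X.hom ≫ Spec.map (CommRingCat.ofHom ((IntermediateField.botEquiv k K :
        (⊥ : IntermediateField k K) ≃ₐ[k] k) : (⊥ : IntermediateField k K) →+* k)))
      (Spec.map (CommRingCat.ofHom (algebraMap (↥(⊥ : IntermediateField k K)) K))) := by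
  haveI := isIso_ofHom_botEquiv k K
  refine (IsPullback.of_hasPullback X.hom (bcSpec k K)).of_iso (Iso.refl _) (Iso.refl _)
    (Iso.refl _) (asIso (Spec.map (CommRingCat.ofHom ((IntermediateField.botEquiv k K :
        (⊥ : IntermediateField k K) ≃ₐ[k] k) : (⊥ : IntermediateField k K) →+* k))))
    (by simp) (by simp) (by rw [Iso.refl_hom, Category.id_comp]; rfl) ?_
  rw [Iso.refl_hom, Category.id_comp, asIso_hom, ← Spec.map_comp, ← CommRingCat.ofHom_comp,
    algebraMap_comp_botEquiv k K]

variable [Normal k K] [LocallyOfFiniteType X.hom] [QuasiCompact X.hom]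

/-- **Every ideal sheaf on `X_K` comes from a finite NORMAL stage** (`K/k` normal algebraic, `X` of
finite type over `k`): there is a subextension `E`, finite and normal over `k`, such that
`(I.map r)·𝒪_{X_K} = I` for EVERY transition map `r : X_K → X_E` over `X` covering
`Spec K → Spec E`.
[cite: GortzWedhorn2020, Thm. 10.66 with Prop. 10.75 (1)] -/
theorem exists_normal_stage (I : (bc K X).IdealSheafData) :
    ∃ (E : IntermediateField k K) (_ : FiniteDimensional k ↥E) (_ : Normal k ↥E),
      ∀ (r : bc K X ⟶ bc (↥E) X),
        r ≫ pullback.fst X.hom (bcSpec k ↥E) = pullback.fst X.hom (bcSpec k K) →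
        r ≫ pullback.snd X.hom (bcSpec k ↥E) =
          pullback.snd X.hom (bcSpec k K) ≫ Spec.map (CommRingCat.ofHom (algebraMap (↥E) K)) →
        (I.map r).comap r = I := by
  haveI := isIso_ofHom_botEquiv k K
  haveI : LocallyOfFiniteType (X.hom ≫ Spec.map (CommRingCat.ofHom
      ((IntermediateField.botEquiv k K : (⊥ : IntermediateField k K) ≃ₐ[k] k) :
        (⊥ : IntermediateField k K) →+* k))) := inferInstance
  haveI : QuasiCompact (X.hom ≫ Spec.map (CommRingCat.ofHom
      ((IntermediateField.botEquiv k K : (⊥ : IntermediateField k K) ≃ₐ[k] k) :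
        (⊥ : IntermediateField k K) →+* k))) := inferInstance
  obtain ⟨E₁, -, hfin₁, H⟩ := closedSubscheme_descent_eventually (E₀ := ⊥) _
    (isPullback_bot_top K X) I
  haveI := hfin₁
  let E : IntermediateField k K := IntermediateField.normalClosure k (↥E₁) K
  have hE₁E : E₁ ≤ E := IntermediateField.le_normalClosure E₁
  refine ⟨E, inferInstance, inferInstance, fun r hr₁ hr₂ => ?_⟩
  obtain ⟨J, hJ⟩ := H E hE₁E inferInstance bot_le (bc (↥E) X) (pullback.fst _ _) (pullback.snd _ _)
    (isPullback_bot_stage K X E) r hr₁ hr₂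
  refine le_antisymm (Scheme.IdealSheafData.comap_map_le _ _) ?_
  calc I = J.comap r := hJ.symm
    _ ≤ (I.map r).comap r := Scheme.IdealSheafData.comap_mono _
        (Scheme.IdealSheafData.le_map_iff_comap_le.mpr hJ.le)

end GaloisDescent

end Literature.AlgebraicGeometry.Motives

end
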